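import Summits.CriticalPhenomena.PercolationContinuityZ3.Theorems.PercNearOneGluingNoHeavyLowerTailSahiCTCRtThreeLocalise
import HarnessLib

/-!
# `NoHeavyLowerTail` (crux stmt-CriticalPhenomena-4575), P3 lane: ROW 0 OF `R_3 ∈ ℕ[s]` REDUCED TO ITS 4-WINDOW —
# `[s^V] R_3 = (Kleitman bulk on tops with ≥ 5 points, ≥ 0) + Σ_{Q ⊆ V, #Q = 4} (local atom sum on Q) + (small pairs)`

Support file (seat `prim-l12-p3`, gen 50; `--supports stmt-CriticalPhenomena-4575`).  Memo
`run/shared/lean/prim/prim-l12/FROM-prim-l12-p3-g50-KLEITMAN-BULK.md` §2, §6.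

With `W_k(a,b,c) = Σ_{t<3} C(k−a−b−c,t)·ω_{k−t}(b+c)` (`ω_m(s) = 1/(m·C(m−1,s))`, `k = #V`) the Kleitman bulk table of `…KleitmanBulk`
(`coeff_ind_Rt_three_eq_atomSum_add`: `[s^V]R_3 = atomSum(W_k) + SP`, `SP` = crossing − nested small pairs), this file
* splits the atom sum into the BULK (top corners with `a+b+c ≥ 5` points) and the WINDOW part (`a+b+c ≤ 4`) (`…Localise.atomSum_split`),
* shows the bulk is `≥ 0` for up-sets (`atomSum_nonneg`; the weights are manifestly `≥ 0`: `kleitmanBulkJ_nonneg`),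
* localises the window part onto the 4-subsets of `V` (`…Localise.atomSum_window_eq_sum_powersetCard`),
and concludes the REDUCTION `coeff_ind_Rt_three_nonneg_of_window`: for a pair of up-sets on `V` (`#V ≥ 4`), if
`Σ_{Q ⊆ V, #Q = 4} atomSum(W_k·[a+b+c ≤ 4] / C(k−a−b−c, 4−a−b−c)) 𝒳 𝒵 Q + SP(𝒳,𝒵,V) ≥ 0` then `[s^V] R_3(𝒳,𝒵) ≥ 0`.  The hypothesis is what the
4-window certificate of the memo (23 atoms with weights in ℚ[k], §2.2) establishes for `k ≥ 10`; it is a statement about the traces of the pair on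
4-sets.  No new definitions; nothing is asserted about the crux.
-/

noncomputable section

open scoped Classical

namespace Summit.CriticalPhenomena.PercolationContinuityZ3.Theorems.SahiCTCForms

open Finset MvPolynomial SahiCTCGenFun

variable {α : Type*} [DecidableEq α]

/-- The Kleitman bulk `J`-table is nonnegative. [this work] -/
theorem kleitmanBulkJ_nonneg (k a b c : ℕ) :
    0 ≤ ∑ t ∈ range 3, (((k - a - b - c).choose t : ℕ) : ℚ) *
        (if b + c < k - t then ((((k - t : ℕ) : ℚ)) * ((((k - t - 1).choose (b + c) : ℕ) : ℚ)))⁻¹ else 0) := by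
  refine sum_nonneg fun t _ => mul_nonneg (by positivity) ?_
  split_ifs <;> positivity

/-- **ROW 0 = BULK + WINDOW + SMALL PAIRS**: for every pair of families and every `V` with `#V ≥ 4`,
`[s^V] R_3 = atomSum(W_k·[a+b+c ≥ 5]) + Σ_{Q ⊆ V, #Q = 4} atomSum(W_k·[a+b+c ≤ 4]/C(#V−(a+b+c), 4−(a+b+c))) on Q + SP`. [this work] -/
theorem coeff_ind_Rt_three_eq_bulk_add_window [Fintype α] (F G : Finset (Finset α)) (V : Finset α) (hV : 4 ≤ #V) :
    (((Rt 3 F G).coeff (ind V) : ℤ) : ℚ) =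
      atomSum (fun a b c => if 5 ≤ a + b + c then ∑ t ∈ range 3, (((#V - a - b - c).choose t : ℕ) : ℚ) *
          (if b + c < #V - t then ((((#V - t : ℕ) : ℚ)) * ((((#V - t - 1).choose (b + c) : ℕ) : ℚ)))⁻¹ else 0) else 0)
        (fun _ _ _ => 0) (fun _ _ _ => 0) (fun _ _ _ => 0) (fun _ _ _ => 0) F G V
      + ∑ Q ∈ V.powersetCard 4, atomSum
          (fun a b c => (if 5 ≤ a + b + c then 0 else ∑ t ∈ range 3, (((#V - a - b - c).choose t : ℕ) : ℚ) *
            (if b + c < #V - t then ((((#V - t : ℕ) : ℚ)) * ((((#V - t - 1).choose (b + c) : ℕ) : ℚ)))⁻¹ else 0))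
            / (((#V - (a + b + c)).choose (4 - (a + b + c)) : ℕ) : ℚ))
          (fun a b c => (0 : ℚ) / (((#V - (a + b + c)).choose (4 - (a + b + c)) : ℕ) : ℚ))
          (fun a b c => (0 : ℚ) / (((#V - (a + b + c)).choose (4 - (a + b + c)) : ℕ) : ℚ))
          (fun a b c => (0 : ℚ) / (((#V - (a + b + c)).choose (4 - (a + b + c)) : ℕ) : ℚ))
          (fun a b c => (0 : ℚ) / (((#V - (a + b + c)).choose (4 - (a + b + c)) : ℕ) : ℚ)) F G Q
      + ∑ S ∈ V.powerset, (((pairsAt (smallXo F G) (smallZo F G) (V \ S) : ℕ) : ℚ) - ((pairsAt (smallN F G) (smallY F G) (V \ S) : ℕ) : ℚ)) := by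
  rw [coeff_ind_Rt_three_eq_atomSum_add]
  -- split the bulk table by `[a+b+c ≥ 5]` (additivity of the atom sum in the tables)
  have hsplit : atomSum (fun a b c => ∑ t ∈ range 3, (((#V - a - b - c).choose t : ℕ) : ℚ) *
          (if b + c < #V - t then ((((#V - t : ℕ) : ℚ)) * ((((#V - t - 1).choose (b + c) : ℕ) : ℚ)))⁻¹ else 0))
        (fun _ _ _ => 0) (fun _ _ _ => 0) (fun _ _ _ => 0) (fun _ _ _ => 0) F G V
      = atomSum (fun a b c => if 5 ≤ a + b + c then ∑ t ∈ range 3, (((#V - a - b - c).choose t : ℕ) : ℚ) *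
          (if b + c < #V - t then ((((#V - t : ℕ) : ℚ)) * ((((#V - t - 1).choose (b + c) : ℕ) : ℚ)))⁻¹ else 0) else 0)
        (fun _ _ _ => 0) (fun _ _ _ => 0) (fun _ _ _ => 0) (fun _ _ _ => 0) F G V
      + atomSum (fun a b c => if 5 ≤ a + b + c then 0 else ∑ t ∈ range 3, (((#V - a - b - c).choose t : ℕ) : ℚ) *
            (if b + c < #V - t then ((((#V - t : ℕ) : ℚ)) * ((((#V - t - 1).choose (b + c) : ℕ) : ℚ)))⁻¹ else 0))
        (fun _ _ _ => 0) (fun _ _ _ => 0) (fun _ _ _ => 0) (fun _ _ _ => 0) F G V := by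
    rw [← atomSum_add]
    unfold atomSum
    refine sum_congr rfl fun A _ => sum_congr rfl fun u _ => sum_congr rfl fun B _ => sum_congr rfl fun v _ => ?_
    congr 1
    by_cases h5 : 5 ≤ #(insert u A ∩ insert v B) + #(insert u A \ insert v B) + #(insert v B \ insert u A)
    · unfold atomΩ; simp only [h5, if_true, add_zero]
    · unfold atomΩ; simp only [h5, if_false, zero_add]
  have hB : atomSum (fun a b c => if 5 ≤ a + b + c then 0 else ∑ t ∈ range 3, (((#V - a - b - c).choose t : ℕ) : ℚ) *
            (if b + c < #V - t then ((((#V - t : ℕ) : ℚ)) * ((((#V - t - 1).choose (b + c) : ℕ) : ℚ)))⁻¹ else 0))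
        (fun _ _ _ => 0) (fun _ _ _ => 0) (fun _ _ _ => 0) (fun _ _ _ => 0) F G V
      = ∑ Q ∈ V.powersetCard 4, atomSum
          (fun a b c => (if 5 ≤ a + b + c then 0 else ∑ t ∈ range 3, (((#V - a - b - c).choose t : ℕ) : ℚ) *
            (if b + c < #V - t then ((((#V - t : ℕ) : ℚ)) * ((((#V - t - 1).choose (b + c) : ℕ) : ℚ)))⁻¹ else 0))
            / (((#V - (a + b + c)).choose (4 - (a + b + c)) : ℕ) : ℚ))
          (fun a b c => (0 : ℚ) / (((#V - (a + b + c)).choose (4 - (a + b + c)) : ℕ) : ℚ))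
          (fun a b c => (0 : ℚ) / (((#V - (a + b + c)).choose (4 - (a + b + c)) : ℕ) : ℚ))
          (fun a b c => (0 : ℚ) / (((#V - (a + b + c)).choose (4 - (a + b + c)) : ℕ) : ℚ))
          (fun a b c => (0 : ℚ) / (((#V - (a + b + c)).choose (4 - (a + b + c)) : ℕ) : ℚ)) F G Q :=
    atomSum_window_eq_sum_powersetCard _ _ _ _ _ V F G (fun a b c h => by simp only [show 5 ≤ a + b + c by omega, if_true])
      (fun _ _ _ _ => rfl) (fun _ _ _ _ => rfl) (fun _ _ _ _ => rfl) (fun _ _ _ _ => rfl) hV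
  rw [hsplit, hB]

/-- **ROW 0 REDUCED TO THE 4-WINDOW**: for a pair of up-sets on `V` (`#V ≥ 4`), if the localised window part plus the small pairs is `≥ 0`,
then `[s^V] R_3(𝒳,𝒵) ≥ 0` — the Kleitman bulk is a nonnegative combination of doubly-pivotal atoms. [this work] -/
theorem coeff_ind_Rt_three_nonneg_of_window [Fintype α] {F G : Finset (Finset α)} (hF : IsUpperSet (F : Set (Finset α)))
    (hG : IsUpperSet (G : Set (Finset α))) (V : Finset α) (hV : 4 ≤ #V)
    (hwin : 0 ≤ ∑ Q ∈ V.powersetCard 4, atomSum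
          (fun a b c => (if 5 ≤ a + b + c then 0 else ∑ t ∈ range 3, (((#V - a - b - c).choose t : ℕ) : ℚ) *
            (if b + c < #V - t then ((((#V - t : ℕ) : ℚ)) * ((((#V - t - 1).choose (b + c) : ℕ) : ℚ)))⁻¹ else 0))
            / (((#V - (a + b + c)).choose (4 - (a + b + c)) : ℕ) : ℚ))
          (fun a b c => (0 : ℚ) / (((#V - (a + b + c)).choose (4 - (a + b + c)) : ℕ) : ℚ))
          (fun a b c => (0 : ℚ) / (((#V - (a + b + c)).choose (4 - (a + b + c)) : ℕ) : ℚ))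
          (fun a b c => (0 : ℚ) / (((#V - (a + b + c)).choose (4 - (a + b + c)) : ℕ) : ℚ))
          (fun a b c => (0 : ℚ) / (((#V - (a + b + c)).choose (4 - (a + b + c)) : ℕ) : ℚ)) F G Q
      + ∑ S ∈ V.powerset, (((pairsAt (smallXo F G) (smallZo F G) (V \ S) : ℕ) : ℚ) - ((pairsAt (smallN F G) (smallY F G) (V \ S) : ℕ) : ℚ))) :
    0 ≤ (Rt 3 F G).coeff (ind V) := by
  have hbulk : 0 ≤ atomSum (fun a b c => if 5 ≤ a + b + c then ∑ t ∈ range 3, (((#V - a - b - c).choose t : ℕ) : ℚ) *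
          (if b + c < #V - t then ((((#V - t : ℕ) : ℚ)) * ((((#V - t - 1).choose (b + c) : ℕ) : ℚ)))⁻¹ else 0) else 0)
        (fun _ _ _ => 0) (fun _ _ _ => 0) (fun _ _ _ => 0) (fun _ _ _ => 0) F G V :=
    atomSum_nonneg _ _ _ _ _ hF hG (fun a b c => by split_ifs; exacts [kleitmanBulkJ_nonneg _ _ _ _, le_rfl])
      (fun _ _ _ => le_rfl) (fun _ _ _ => le_rfl) (fun _ _ _ => le_rfl) (fun _ _ _ => le_rfl) V
  have h := coeff_ind_Rt_three_eq_bulk_add_window F G V hV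
  have : (0 : ℚ) ≤ (((Rt 3 F G).coeff (ind V) : ℤ) : ℚ) := by rw [h, add_assoc]; exact add_nonneg hbulk hwin
  exact_mod_cast this

end Summit.CriticalPhenomena.PercolationContinuityZ3.Theorems.SahiCTCForms
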